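import Literature.NumberTheory.Rogawski1990.ArchExplicitTransferFactorCentralCurveDelta     -- ★ G3 (F0P3a-p05 (g11)); brings ★ G1∕G2, ★ `ArchSingularCurveNormPair`, ★ `CurveSmooth`
import Literature.NumberTheory.Automorphic.ArchStableClassTorus                              -- ★ (V8) `isStablyConj_archDiagTorus_iff_exists_of_conj`
import HarnessLib

/-!
# Rogawski's explicit archimedean factor along the central curve — the RELABELLED partners `γ′_ρ(ψ) = t(z(ψ)∘ρ)` (the other classes of the stable class)
# (Rogawski 1990 §14.5 Lemma 14.5.2 (c) p. 238; §14.6 p. 242; §4.1 (4.1.1) p. 39)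

Topic `NumberTheory/Rogawski1990`; namespace `Literature.NumberTheory.Rogawski1990`.  THEOREMS ONLY (no definition, no named fact, no instance, no notation, no `sorry`).
Cell `pub/hodgecm-mathlib`, ENGINE T1 (crux H413 = `stmt-HodgeConjecture-24833`); floor-1½ preparation, count-neutral, under row (S-c) ∕ `stub_ScCore` of the «SdArch» pay-down line:
brick **(3G-c)** of F0P3a-p02 (g10)'s (R3-f) STEP 3 census (05:27Z) — FILE G4 of the central-curve series (G1 ★ `…CentralCurve`, G2 ★ `…CentralCurveTau`, G3 ★ `…CentralCurveDelta`);
LEAD F0P3a-plan (g9) T8-73 (A); author F0P3a-p05 (g11).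

WHY.  In (vi) at the torus point `γ_H(ψ)` the `G′`-side sums over ALL classes `c′` matching `ι(γ_H(ψ))`, i.e. (★ (V8) `conjClasses_stable_archDiagTorus_eq_range_of_conj`) over the relabelled
torus points `γ′_ρ(ψ) = t(w ↦ z(ψ)_w ∘ ρ_w)`, `ρ : W → S₃`.  G1–G3 treat `ρ = 1`; here the same algebra and bounds for every `ρ`: `τ` and `D_{G∕H,∞}` depend on `γ_H` only (★ G1∕G2 verbatim),
while the eigenline of `γ′_ρ` at `w` sits in slot `(ρ_w)⁻¹(1)` — so `κ_w(γ_H(ψ), γ′_ρ(ψ)) = sgn(re σ_w(α_{ρ_w⁻¹(1)}))·η_w`, again INDEPENDENT of `ψ`.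

WHAT IS PROVED (binders of ★ G1 + `ρ`, `γGρ` with `hγGρ : γGρ = fun ψ => archDiagTorus L 3 α fun w => (fun i => z₀ w i * Circle.exp (![1,0,-1] i * (c w * ψ))) ∘ ρ w`).
* §1 `map_evalC_archSingularCurveG_relabel`; **`isArchNormPair_archSingularCurve_relabel`** (`ι(γ_H(ψ)) ↔ γ′_ρ(ψ)` for every `ψ`, `ρ`); **`archEigenlineProjector_archSingularCurve_relabel`**
  (`P_w = diagonal (i ↦ if ρ_w i = 1 then (u−a)(u−b) else 0)`); **`archKappaAt_archSingularCurve_relabel_eq_of_ne_zero`**; **`prod_archKappaAt_centralCurve_relabel_eq_of_cos_ne_one`**.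
* §2 (central base, unitary `μ`): **`archExplicitDelta_centralCurve_relabel_eq`** (`Δ″(γ_H(ψ), γ′_ρ(ψ)) = τ(ψ)·K_D(2 − 2cos c_{w₀}ψ)·K_κ(ρ)`), `norm_archExplicitDelta_centralCurve_relabel_le(_sq)`,
  `archExplicitDelta_centralCurve_relabel_zero`, **`hasDerivAt_archExplicitDelta_centralCurve_relabel_zero`** — G3 §1 re-run with `K_κ(ρ)`; the derivative bounds (G3 §2–§3 for `ρ`)
  are FILE G4b ★ `ArchExplicitTransferFactorCentralCurveRelabelDeriv`.
HONEST LABEL: HC_CM is proved only modulo the printed citations until rung 0 closes; this file is algebra∕calculus along a curve and pays nothing by itself.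

## References
* [Rogawski1990] J. D. Rogawski, *Automorphic Representations of Unitary Groups in Three Variables*, Ann. of Math. Stud. 123 (1990): §14.5 Lemma 14.5.2 (c), p. 238; §14.6 p. 242; §4.1 (4.1.1)
  p. 39; §4.9 p. 55.
* [LanglandsShelstad1987] R. P. Langlands, D. Shelstad, *On the definition of transfer factors*, Math. Ann. 278 (1987), §2.
-/

set_option autoImplicit false

noncomputable section

open NumberField NumberField.InfinitePlace Matrix Polynomial Filter Topology Complex Equiv
open scoped MatrixGroups Real

namespace Literature.NumberTheory.Rogawski1990

open Literature.NumberTheory.Automorphic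
open Literature.NumberTheory.GaloisRepresentations

/-! ## §0 Scalar helpers (private) -/

/-- `2 − 2cos x ≤ x²`. [folklore] -/
private theorem two_sub_two_mul_cos_le_sq' (x : ℝ) : 2 - 2 * Real.cos x ≤ x ^ 2 := by
  have h := Real.one_sub_sq_div_two_le_cos (x := x)
  linarith

/-- `0 ≤ 2 − 2cos x`. [folklore] -/
private theorem two_sub_two_mul_cos_nonneg' (x : ℝ) : 0 ≤ 2 - 2 * Real.cos x := by
  have h := Real.cos_le_one x
  linarith

/-- `sgn(|q|²·r) = sgn r` for `q ≠ 0`. [folklore] -/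
private theorem sign_normSq_mul' {q : ℂ} (hq : q ≠ 0) (r : ℝ) : SignType.sign (Complex.normSq q * r) = SignType.sign r := by
  rw [sign_mul, (sign_pos (Complex.normSq_pos.mpr hq) : SignType.sign (Complex.normSq q) = 1), one_mul]

/-- The scalar identity behind `χ_g(d) = (d − a)(d − b)` on the three diagonal slots. [folklore] -/
private theorem charpoly_slot_eq (A U B : ℂ) (k : Fin 3) :
    ![A, U, B] k * ![A, U, B] k - ((A + B) / 2 + (A + B) / 2) * ![A, U, B] k + ((A + B) / 2 * ((A + B) / 2) - (A - B) / 2 * ((A - B) / 2)) =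
      if k = 1 then (U - A) * (U - B) else 0 := by
  fin_cases k <;> simp <;> ring

section Curve

variable (L : Type) [Field L] [NumberField L] [IsCMField L] (α : Fin 3 → L)
  (z₀ : {w : InfinitePlace L // IsComplex w} → Fin 3 → Circle) (c : {w : InfinitePlace L // IsComplex w} → ℝ)
  (γH : ℝ →
    ↥(UnitaryGroup.arch (↥(maximalRealSubfield L)) L (IsCMField.complexConj L) 2
        (Matrix.of fun i j : Fin 2 => if i.val + j.val + 1 = 2 then (1 : L) else 0)) ×
      ↥(UnitaryGroup.arch (↥(maximalRealSubfield L)) L (IsCMField.complexConj L) 1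
        (Matrix.of fun i j : Fin 1 => if i.val + j.val + 1 = 1 then (1 : L) else 0)))
  (γG : ℝ → ↥(UnitaryGroup.arch (↥(maximalRealSubfield L)) L (IsCMField.complexConj L) 3 (Matrix.diagonal α)))
  (hγH : γH = fun ψ =>
    ((UnitaryGroup.archPiEquivCM 2 L (Matrix.of fun i j : Fin 2 => if i.val + j.val + 1 = 2 then (1 : L) else 0)).symm fun w =>
        ⟨Matrix.GeneralLinearGroup.mkOfDetNeZero !![(1 : ℂ), 1; 1, -1] UnitaryGroup.det_cayleyTwo_ne_zero *
            UnitaryGroup.circleDiagonal 2 ![z₀ w 0 * Circle.exp (![(1 : ℝ), 0, -1] 0 * (c w * ψ)), z₀ w 2 * Circle.exp (![(1 : ℝ), 0, -1] 2 * (c w * ψ))] *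
          (Matrix.GeneralLinearGroup.mkOfDetNeZero !![(1 : ℂ), 1; 1, -1] UnitaryGroup.det_cayleyTwo_ne_zero)⁻¹,
          UnitaryGroup.cayley_conj_circleDiagonal_mem_archLocal L w _⟩,
      (UnitaryGroup.archPiEquivCM 1 L (Matrix.of fun i j : Fin 1 => if i.val + j.val + 1 = 1 then (1 : L) else 0)).symm fun w =>
        ⟨UnitaryGroup.circleDiagonal 1 ![z₀ w 1 * Circle.exp (![(1 : ℝ), 0, -1] 1 * (c w * ψ))],
          UnitaryGroup.circleDiagonal_mem_archLocal_antidiagOne L w _⟩))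
  (hγG : γG = fun ψ => UnitaryGroup.archDiagTorus L 3 α fun w i => z₀ w i * Circle.exp (![(1 : ℝ), 0, -1] i * (c w * ψ)))

  (ρ : {w : InfinitePlace L // IsComplex w} → Perm (Fin 3))
  (γGρ : ℝ → ↥(UnitaryGroup.arch (↥(maximalRealSubfield L)) L (IsCMField.complexConj L) 3 (Matrix.diagonal α)))
  (hγGρ : γGρ = fun ψ => UnitaryGroup.archDiagTorus L 3 α fun w => (fun i => z₀ w i * Circle.exp (![(1 : ℝ), 0, -1] i * (c w * ψ))) ∘ ρ w)
  (w₀ : {w : InfinitePlace L // IsComplex w}) (μ : HeckeCharacter L)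

/-! ## §1 The relabelled partner: components, matching, eigenline projector, `κ` -/

include hγGρ in
/-- The `w`-component of `γ′_ρ(ψ)` is `diag((a_w, u_w, b_w) ∘ ρ_w)` (★ `archAt_archDiagTorus`). [cite: Rogawski1990, §4.1 (4.1.1) p. 39] -/
theorem map_evalC_archSingularCurveG_relabel (ψ : ℝ) (w : {w : InfinitePlace L // IsComplex w}) :
    Matrix.GeneralLinearGroup.map (UnitaryGroup.evalC L w) ((γGρ ψ : ↥(UnitaryGroup.arch (↥(maximalRealSubfield L)) L (IsCMField.complexConj L) 3 (Matrix.diagonal α))) : GL (Fin 3) (mixedEmbedding.mixedSpace L)) =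
      UnitaryGroup.circleDiagonal 3 ((fun i => z₀ w i * Circle.exp (![(1 : ℝ), 0, -1] i * (c w * ψ))) ∘ ρ w) := by
  subst hγGρ
  exact UnitaryGroup.archAt_archDiagTorus L 3 α _ w

include hγH hγG hγGρ in
/-- **`ι(γ_H(ψ)) ↔ γ′_ρ(ψ)` for every `ψ` and every relabelling `ρ`**: `γ′_ρ(ψ)` is stably conjugate to `γ′(ψ) = γ′_1(ψ)` (★ (V8) `isStablyConj_archDiagTorus_iff_exists_of_conj`) and matching only sees the
stable class (★ `Corresponds.of_isStablyConj_right`, ★ `isArchNormPair_archSingularCurve`). [cite: Rogawski1990, §4.1 (4.1.1) p. 39; §14.1 p. 232] -/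
theorem isArchNormPair_archSingularCurve_relabel (ψ : ℝ) : IsArchNormPair L (Matrix.diagonal α) (γH ψ) (γGρ ψ) := by
  have h0 := isArchNormPair_archSingularCurve L α z₀ c γH γG hγH hγG ψ
  rw [isArchNormPair_iff] at h0 ⊢
  refine h0.of_isStablyConj_right ?_
  rw [hγG, hγGρ]
  exact (UnitaryGroup.isStablyConj_archDiagTorus_iff_exists_of_conj L 3 α _ _).mpr ⟨ρ, rfl⟩

include hγH hγGρ in
/-- **THE EIGENLINE PROJECTOR ON THE RELABELLED PARTNER**: `P_w(γ_H(ψ), γ′_ρ(ψ)) = χ_{g_w}(γ′_ρ,w) = diagonal(i ↦ if ρ_w i = 1 then (u_w − a_w)(u_w − b_w) else 0)` — the `u`-eigenline sits in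
slot `ρ_w⁻¹(1)`. [cite: Rogawski1990, §14.6 p. 242; §4.9 p. 55] -/
theorem archEigenlineProjector_archSingularCurve_relabel (ψ : ℝ) (w : {w : InfinitePlace L // IsComplex w}) :
    archEigenlineProjector L (Matrix.diagonal α) (γH ψ) w (γGρ ψ) =
      Matrix.diagonal fun i => if ρ w i = 1 then ((z₀ w 1 : ℂ) - ((z₀ w 0 * Circle.exp (![(1 : ℝ), 0, -1] 0 * (c w * ψ)) : Circle) : ℂ)) * ((z₀ w 1 : ℂ) - ((z₀ w 2 * Circle.exp (![(1 : ℝ), 0, -1] 2 * (c w * ψ)) : Circle) : ℂ)) else 0 := by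
  set A : ℂ := ((z₀ w 0 * Circle.exp (![(1 : ℝ), 0, -1] 0 * (c w * ψ)) : Circle) : ℂ) with hA
  set B : ℂ := ((z₀ w 2 * Circle.exp (![(1 : ℝ), 0, -1] 2 * (c w * ψ)) : Circle) : ℂ) with hB
  set U : ℂ := ((z₀ w 1 * Circle.exp (![(1 : ℝ), 0, -1] 1 * (c w * ψ)) : Circle) : ℂ) with hU
  have hU1 : U = (z₀ w 1 : ℂ) := by
    rw [hU]; simp only [Matrix.cons_val_one, Matrix.cons_val_zero, zero_mul, Circle.exp_zero, mul_one]
  have hG : ((((γGρ ψ : ↥(UnitaryGroup.arch (↥(maximalRealSubfield L)) L (IsCMField.complexConj L) 3 (Matrix.diagonal α))) : GL (Fin 3) (mixedEmbedding.mixedSpace L)) : Matrix (Fin 3) (Fin 3) (mixedEmbedding.mixedSpace L)).map (UnitaryGroup.evalC L w)) =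
      Matrix.diagonal fun i => ![A, U, B] (ρ w i) := by
    have h := congrArg (fun g : GL (Fin 3) ℂ => (g : Matrix (Fin 3) (Fin 3) ℂ)) (map_evalC_archSingularCurveG_relabel L α z₀ c ρ γGρ hγGρ ψ w)
    rw [UnitaryGroup.coe_circleDiagonal] at h
    refine (Eq.trans rfl h : _).trans ?_
    congr 1
    funext i
    simp only [Function.comp_apply]
    generalize ρ w i = k
    fin_cases k <;> rfl
  have hH := coe_map_evalC_fst_archSingularCurveH L z₀ c γH hγH ψ w
  rw [← hA, ← hB] at hH
  unfold archEigenlineProjector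
  simp only []
  rw [hG, hH, Matrix.trace_fin_two_of, Matrix.det_fin_two_of, ← hU1, Matrix.diagonal_mul_diagonal]
  ext i j
  simp only [Matrix.sub_apply, Matrix.add_apply, Matrix.smul_apply, Matrix.diagonal_apply, Matrix.one_apply, smul_eq_mul]
  by_cases hij : i = j
  · subst hij
    simp only [if_true, mul_one]
    exact charpoly_slot_eq A U B (ρ w i)
  · simp [hij]

include hγH hγGρ in
/-- **`κ_w` ON THE RELABELLED PARTNER IS EXPLICIT AND `ψ`-FREE**: whenever `(u_w − a_w(ψ))(u_w − b_w(ψ)) ≠ 0`,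
`κ_w(γ_H(ψ), γ′_ρ(ψ)) = sgn(re σ_w(α_{ρ_w⁻¹(1)})) · η_w(diag α)` — the sign of the form on the coordinate line `ρ_w⁻¹(1)` where `u` sits. [cite: Rogawski1990, §14.6 p. 242]
[cite: LanglandsShelstad1987, §2] -/
theorem archKappaAt_archSingularCurve_relabel_eq_of_ne_zero (ψ : ℝ) (w : {w : InfinitePlace L // IsComplex w})
    (hq : ((z₀ w 1 : ℂ) - ((z₀ w 0 * Circle.exp (![(1 : ℝ), 0, -1] 0 * (c w * ψ)) : Circle) : ℂ)) * ((z₀ w 1 : ℂ) - ((z₀ w 2 * Circle.exp (![(1 : ℝ), 0, -1] 2 * (c w * ψ)) : Circle) : ℂ)) ≠ 0) :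
    archKappaAt L (Matrix.diagonal α) (γH ψ) w (γGρ ψ) =
      (SignType.sign ((w.1.embedding (α ((ρ w).symm 1))).re) : ℤ) * archMajoritySign L (Matrix.diagonal α) w := by
  unfold archKappaAt
  rw [archEigenlineProjector_archSingularCurve_relabel L α z₀ c γH hγH ρ γGρ hγGρ ψ w]
  set q : ℂ := ((z₀ w 1 : ℂ) - ((z₀ w 0 * Circle.exp (![(1 : ℝ), 0, -1] 0 * (c w * ψ)) : Circle) : ℂ)) * ((z₀ w 1 : ℂ) - ((z₀ w 2 * Circle.exp (![(1 : ℝ), 0, -1] 2 * (c w * ψ)) : Circle) : ℂ)) with hqdef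
  rw [Matrix.diagonal_map (map_zero _), Matrix.diagonal_conjTranspose, Matrix.diagonal_mul_diagonal, Matrix.diagonal_mul_diagonal, Matrix.trace_diagonal]
  congr 2
  -- only the slot `i₀ = ρ_w⁻¹ 1` contributes
  rw [Finset.sum_eq_single ((ρ w).symm 1)]
  · simp only [Pi.star_apply, Equiv.apply_symm_apply, if_true]
    have h : star q * w.1.embedding (α ((ρ w).symm 1)) * q = w.1.embedding (α ((ρ w).symm 1)) * (Complex.normSq q : ℂ) := by
      rw [Complex.star_def, ← Complex.mul_conj]
      ring
    rw [h, mul_comm, Complex.re_ofReal_mul, sign_normSq_mul' hq]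
  · intro i _ hi
    have hne : ρ w i ≠ 1 := fun h => hi (by rw [← h, Equiv.symm_apply_apply])
    simp only [Pi.star_apply, hne, if_false, star_zero, zero_mul]
  · intro h; exact absurd (Finset.mem_univ _) h

include hγH hγGρ in
open scoped Classical in
/-- **AT THE CENTRAL BASE: `∏_w κ_w(γ_H(ψ), γ′_ρ(ψ)) = K_κ(ρ) := ∏_w sgn(re σ_w(α_{ρ_w⁻¹(1)}))·η_w` for every `ψ` with `cos(c_{w₀}ψ) ≠ 1`** (★ G1 non-vanishing of `(u−a)(u−b)` at such `ψ`).
[cite: Rogawski1990, §14.6 p. 242; §14.5 p. 238] -/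
theorem prod_archKappaAt_centralCurve_relabel_eq_of_cos_ne_one (hc : ∀ w, w ≠ w₀ → c w = 0) (hcen : z₀ w₀ 0 = z₀ w₀ 1 ∧ z₀ w₀ 2 = z₀ w₀ 1)
    (hreg : ∀ w, w ≠ w₀ → z₀ w 1 ≠ z₀ w 0 ∧ z₀ w 1 ≠ z₀ w 2) {ψ : ℝ} (hψ : Real.cos (c w₀ * ψ) ≠ 1) :
    (∏ w : {w : InfinitePlace L // IsComplex w}, archKappaAt L (Matrix.diagonal α) (γH ψ) w (γGρ ψ)) = (∏ w : {w : InfinitePlace L // IsComplex w}, ((SignType.sign ((w.1.embedding (α ((ρ w).symm 1))).re) : ℤ) * archMajoritySign L (Matrix.diagonal α) w)) := by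
  refine Finset.prod_congr rfl fun w _ => archKappaAt_archSingularCurve_relabel_eq_of_ne_zero L α z₀ c γH hγH ρ γGρ hγGρ ψ w ?_
  rw [← evalC_eval_archCharpolyTwo_archSingularCurveH L z₀ c γH hγH ψ w]
  by_cases hw : w = w₀
  · subst hw
    rw [evalC_eval_archCharpolyTwo_centralCurve_self L z₀ c γH hγH w hcen ψ]
    refine mul_ne_zero (pow_ne_zero _ (Circle.coe_ne_zero _)) ?_
    intro h0
    apply hψ
    have h1 : (Real.cos (c w * ψ) : ℂ) = 1 := by linear_combination -h0 / 2
    exact_mod_cast h1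
  · rw [evalC_eval_archCharpolyTwo_centralCurve_of_ne L z₀ c γH hγH w₀ hc ψ hw]
    exact mul_ne_zero (sub_ne_zero.mpr fun h => (hreg w hw).1 (Circle.ext h)) (sub_ne_zero.mpr fun h => (hreg w hw).2 (Circle.ext h))

omit [IsCMField L] in
open scoped Classical in
/-- **`|K_κ(ρ)| ≤ 1`**: each factor `sgn(re σ_w(α_{ρ_w⁻¹(1)}))·η_w ∈ {−1, 0, 1}` (★ `archMajoritySign_eq_one_or_eq_neg_one`). [cite: Rogawski1990, §14.6 p. 242] -/
theorem norm_cast_prod_sign_mul_archMajoritySign_relabel_le_one : ‖(((∏ w : {w : InfinitePlace L // IsComplex w}, ((SignType.sign ((w.1.embedding (α ((ρ w).symm 1))).re) : ℤ) * archMajoritySign L (Matrix.diagonal α) w)) : ℤ) : ℂ)‖ ≤ 1 := by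
  rw [Int.cast_prod, norm_prod]
  refine Finset.prod_le_one (fun _ _ => norm_nonneg _) fun w _ => ?_
  rw [Int.cast_mul, norm_mul]
  have h1 : ‖((SignType.sign ((w.1.embedding (α ((ρ w).symm 1))).re) : ℤ) : ℂ)‖ ≤ 1 := by
    generalize SignType.sign ((w.1.embedding (α ((ρ w).symm 1))).re) = t
    rcases t <;> simp
  have h2 : ‖((archMajoritySign L (Matrix.diagonal α) w : ℤ) : ℂ)‖ ≤ 1 := by
    rcases archMajoritySign_eq_one_or_eq_neg_one L (Matrix.diagonal α) w with h | h <;> simp [h]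
  exact mul_le_one₀ h1 (norm_nonneg _) h2

/-! ## §2 `Δ″(γ_H(ψ), γ′_ρ(ψ))` at the central base: the product and G3's bounds -/

include hγH hγG hγGρ in
open scoped Classical in
/-- **`Δ″_∞(γ_H(ψ), γ′_ρ(ψ)) = τ(ψ) · K_D(2 − 2cos(c_{w₀}ψ)) · K_κ(ρ)`** for `cos(c_{w₀}ψ) ≠ 1`. [cite: Rogawski1990, §4.9 p. 55; §14.6 p. 242] -/
theorem archExplicitDelta_centralCurve_relabel_eq (hc : ∀ w, w ≠ w₀ → c w = 0) (hcen : z₀ w₀ 0 = z₀ w₀ 1 ∧ z₀ w₀ 2 = z₀ w₀ 1)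
    (hreg : ∀ w, w ≠ w₀ → z₀ w 1 ≠ z₀ w 0 ∧ z₀ w 1 ≠ z₀ w 2) {ψ : ℝ} (hψ : Real.cos (c w₀ * ψ) ≠ 1) :
    archExplicitDelta L (Matrix.diagonal α) (γH ψ) μ (γGρ ψ) =
      archTau L (γH ψ) μ * (((∏ w ∈ Finset.univ.erase w₀, ‖((z₀ w 1 : ℂ) - z₀ w 0) * ((z₀ w 1 : ℂ) - z₀ w 2)‖) * (2 - 2 * Real.cos (c w₀ * ψ)) : ℝ) : ℂ) * (((∏ w : {w : InfinitePlace L // IsComplex w}, ((SignType.sign ((w.1.embedding (α ((ρ w).symm 1))).re) : ℤ) * archMajoritySign L (Matrix.diagonal α) w)) : ℤ) : ℂ) := by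
  rw [archExplicitDelta_of_isArchNormPair L (Matrix.diagonal α) (γH ψ) μ (isArchNormPair_archSingularCurve_relabel L α z₀ c γH γG hγH hγG ρ γGρ hγGρ ψ),
    archWeylRatio_centralCurve L z₀ c γH hγH w₀ hc hcen ψ, prod_archKappaAt_centralCurve_relabel_eq_of_cos_ne_one L α z₀ c γH hγH ρ γGρ hγGρ w₀ hc hcen hreg hψ]

include hγH hγG hγGρ in
open scoped Classical in
/-- **`‖Δ″_∞(γ_H(ψ), γ′_ρ(ψ))‖ ≤ K_D · (2 − 2cos(c_{w₀}ψ))` for EVERY `ψ`** (unitary `μ`). [cite: Rogawski1990, §14.5 p. 238; §4.9 p. 55] -/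
theorem norm_archExplicitDelta_centralCurve_relabel_le (hμu : μ.IsUnitary) (hc : ∀ w, w ≠ w₀ → c w = 0) (hcen : z₀ w₀ 0 = z₀ w₀ 1 ∧ z₀ w₀ 2 = z₀ w₀ 1)
    (hreg : ∀ w, w ≠ w₀ → z₀ w 1 ≠ z₀ w 0 ∧ z₀ w 1 ≠ z₀ w 2) (ψ : ℝ) :
    ‖archExplicitDelta L (Matrix.diagonal α) (γH ψ) μ (γGρ ψ)‖ ≤ (∏ w ∈ Finset.univ.erase w₀, ‖((z₀ w 1 : ℂ) - z₀ w 0) * ((z₀ w 1 : ℂ) - z₀ w 2)‖) * (2 - 2 * Real.cos (c w₀ * ψ)) := by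
  have hK : 0 ≤ (∏ w ∈ Finset.univ.erase w₀, ‖((z₀ w 1 : ℂ) - z₀ w 0) * ((z₀ w 1 : ℂ) - z₀ w 2)‖) := Finset.prod_nonneg fun _ _ => norm_nonneg _
  by_cases hψ : Real.cos (c w₀ * ψ) = 1
  · rw [archExplicitDelta_of_isArchNormPair L (Matrix.diagonal α) (γH ψ) μ (isArchNormPair_archSingularCurve_relabel L α z₀ c γH γG hγH hγG ρ γGρ hγGρ ψ),
      archWeylRatio_centralCurve L z₀ c γH hγH w₀ hc hcen ψ, hψ]
    simp
  · rw [archExplicitDelta_centralCurve_relabel_eq L α z₀ c γH γG hγH hγG ρ γGρ hγGρ w₀ μ hc hcen hreg hψ, norm_mul, norm_mul,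
      norm_archTau_centralCurve_eq_one L z₀ c γH hγH w₀ μ hμu hc hcen hreg hψ, one_mul, Complex.norm_real,
      Real.norm_of_nonneg (mul_nonneg hK (two_sub_two_mul_cos_nonneg' _))]
    exact mul_le_of_le_one_right (mul_nonneg hK (two_sub_two_mul_cos_nonneg' _)) (norm_cast_prod_sign_mul_archMajoritySign_relabel_le_one L α ρ)

include hγH hγG hγGρ in
open scoped Classical in
/-- **`‖Δ″_∞(γ_H(ψ), γ′_ρ(ψ))‖ ≤ K_D · c_{w₀}² · ψ²`** for every `ψ`. [cite: Rogawski1990, §14.5 p. 238] -/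
theorem norm_archExplicitDelta_centralCurve_relabel_le_sq (hμu : μ.IsUnitary) (hc : ∀ w, w ≠ w₀ → c w = 0) (hcen : z₀ w₀ 0 = z₀ w₀ 1 ∧ z₀ w₀ 2 = z₀ w₀ 1)
    (hreg : ∀ w, w ≠ w₀ → z₀ w 1 ≠ z₀ w 0 ∧ z₀ w 1 ≠ z₀ w 2) (ψ : ℝ) :
    ‖archExplicitDelta L (Matrix.diagonal α) (γH ψ) μ (γGρ ψ)‖ ≤ (∏ w ∈ Finset.univ.erase w₀, ‖((z₀ w 1 : ℂ) - z₀ w 0) * ((z₀ w 1 : ℂ) - z₀ w 2)‖) * (c w₀) ^ 2 * ψ ^ 2 := by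
  refine (norm_archExplicitDelta_centralCurve_relabel_le L α z₀ c γH γG hγH hγG ρ γGρ hγGρ w₀ μ hμu hc hcen hreg ψ).trans ?_
  rw [mul_assoc, ← mul_pow]
  exact mul_le_mul_of_nonneg_left (two_sub_two_mul_cos_le_sq' _) (Finset.prod_nonneg fun _ _ => norm_nonneg _)

include hγH hγG hγGρ in
/-- **`Δ″_∞(γ_H(0), γ′_ρ(0)) = 0`**. [cite: Rogawski1990, §14.5 p. 238] -/
theorem archExplicitDelta_centralCurve_relabel_zero (hμu : μ.IsUnitary) (hc : ∀ w, w ≠ w₀ → c w = 0) (hcen : z₀ w₀ 0 = z₀ w₀ 1 ∧ z₀ w₀ 2 = z₀ w₀ 1)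
    (hreg : ∀ w, w ≠ w₀ → z₀ w 1 ≠ z₀ w 0 ∧ z₀ w 1 ≠ z₀ w 2) :
    archExplicitDelta L (Matrix.diagonal α) (γH 0) μ (γGρ 0) = 0 := by
  have h := norm_archExplicitDelta_centralCurve_relabel_le_sq L α z₀ c γH γG hγH hγG ρ γGρ hγGρ w₀ μ hμu hc hcen hreg 0
  simp only [ne_eq, OfNat.ofNat_ne_zero, not_false_eq_true, zero_pow, mul_zero, norm_le_zero_iff] at h
  exact h

include hγH hγG hγGρ in
/-- **`HasDerivAt (ψ ↦ Δ″_∞(γ_H(ψ), γ′_ρ(ψ))) 0 0`**. [cite: Rogawski1990, §14.5 Lemma 14.5.2 (c), p. 238] -/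
theorem hasDerivAt_archExplicitDelta_centralCurve_relabel_zero (hμu : μ.IsUnitary) (hc : ∀ w, w ≠ w₀ → c w = 0) (hcen : z₀ w₀ 0 = z₀ w₀ 1 ∧ z₀ w₀ 2 = z₀ w₀ 1)
    (hreg : ∀ w, w ≠ w₀ → z₀ w 1 ≠ z₀ w 0 ∧ z₀ w 1 ≠ z₀ w 2) :
    HasDerivAt (fun ψ => archExplicitDelta L (Matrix.diagonal α) (γH ψ) μ (γGρ ψ)) 0 0 := by
  classical
  rw [hasDerivAt_iff_isLittleO, archExplicitDelta_centralCurve_relabel_zero L α z₀ c γH γG hγH hγG ρ γGρ hγGρ w₀ μ hμu hc hcen hreg]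
  simp only [sub_zero, smul_zero]
  refine Asymptotics.IsBigO.trans_isLittleO (g := fun ψ : ℝ => ψ ^ 2) ?_ ?_
  · refine Asymptotics.IsBigO.of_bound ((∏ w ∈ Finset.univ.erase w₀, ‖((z₀ w 1 : ℂ) - z₀ w 0) * ((z₀ w 1 : ℂ) - z₀ w 2)‖) * (c w₀) ^ 2) (Filter.Eventually.of_forall fun ψ => ?_)
    rw [Real.norm_eq_abs, abs_pow, sq_abs]
    exact norm_archExplicitDelta_centralCurve_relabel_le_sq L α z₀ c γH γG hγH hγG ρ γGρ hγGρ w₀ μ hμu hc hcen hreg ψ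
  · simpa using (Asymptotics.isLittleO_pow_id (one_lt_two : 1 < 2) : (fun ψ : ℝ => ψ ^ 2) =o[𝓝 0] fun ψ => ψ)

end Curve

end Literature.NumberTheory.Rogawski1990

end
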